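import Literature.NumberTheory.LFunctions.Zhang2022.RepairRplus
import Literature.NumberTheory.LFunctions.KMVMollifiedMomentForms
import Literature.NumberTheory.LFunctions.OnePieceMollifierCeiling
import Literature.NumberTheory.LFunctions.CentralValueFamilyForcedSplitTotal
import HarnessLib

/-!
# Zhang (2022), programme F-S3 §E (cell landau-siegel, barrier extension, stub S-E-bf1-1): INTAKE of the §B word
# KILL(B-fam) — the class `K_fam = K_fam^diag ∪ K_fam^(A)` (Iwaniec–Sarnak GL(2)-family mollifier designs) as the
# list `bfamWord = [familyBfamDiag, familyBfamBeyond, familyBfamNarrow]`, ONE design family per STATUS of the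
# word — (I) decided BY THEOREM · (II-a) CONDITIONAL on three displayed printed inputs · (II-b) GIVEN B-AH(fam),
# 0 rows evaluated — and their union `familyBfam`; `bfamWord_decided` (kind INTAKE-3: list + verbatim text + flags)

H. Iwaniec, *Conversations on the exceptional character*, LNM 1891 (2006) §7 [IwaniecConversations2006];
E. Kowalski, P. Michel, J. VanderKam, *Non-vanishing of high derivatives of automorphic L-functions at the center of the
critical strip*, J. reine angew. Math. 526 (2000) 1–34 [KowalskiMichelVanderKam2000; held paper:doi-10-1515-crll-2000-074 —
Props 4.1/5.1, Thm 6.1 (32), §7 p. 21, §8.4 p. 28 are THIS paper's]; programme context: Y. Zhang, *Discrete mean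
estimates and the Landau–Siegel zero*, arXiv:2211.02515v1 [Zhang2022LandauSiegel] — an unrefereed manuscript under
adjudication. **WHAT THIS IS NOT: not a claim about Theorems 1–2 of arXiv:2211.02515, about Landau–Siegel zeros,
about a repaired `Margin232`, about Parity, and not a theorem «the class K_fam is decided»: an INTAKE records the
word's LIST, its TEXT verbatim and its FLAGS; every verdict term below is a landed theorem cited by name or a
displayed hypothesis. The programme SEARCHES and TYPES; no claim about Landau–Siegel zeros, Theorems 1–2 of
arXiv:2211.02515 or a repaired Margin232 until a kernel theorem says so.**

## The word (C1 — the certificate's §1 VERBATIM)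

Certificate OF RECORD: HOME/B-fam/KILL-draft.md **v2.2.2 sha16 06cd652c2917c102** (§1 = file lines 4–6, sha16
817b59c08b1564d9; §2 class text sha16 b6c520d7224008a5 — REF-B3-audited); word = director-frontier g6 STATUS
2026-08-26T20:55:00Z «KILL ISSUED», stamps (i) ls-Bfam-plan 20:59:55Z, (ii) REF-B3 (ls-B-ref-3 g2) 21:15:26Z =
KILLED OF RECORD (B-fam/PLAN.md v1.4 §11 WORD OF RECORD); intake pre-brief barrier/REF-E.md §0b-v9 (C1–C7, kind
INTAKE-3); spec ls-barrier-plan g1 21:01:53Z / owner swap 21:40:19Z (this file: ls-Bfam-typer-2 g2; the member file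
`RepairIntakeBfamMembers` against the constructor field types below: ls-Bfam-typer-1 g2 after ACCEPT); liaison index
B-fam/EDLIST.md v1.11.5 167b170ddb9c23f5, DESIGN-MAP-fam.md v1.7.2 1fab3aab1d5f89c5, PLAN.md v1.4 §11 (living pointers, not part of
the frozen text). NOTE ON NAMES: the declaration names occurring
inside the quotation are the WORD'S TEXT; rider W5 there names five `D = 1`-inclusive displays as VACUOUS (not
wrong) — those five names occur in this file ONLY inside this quotation and in NO declaration, display or proof
below (C3 grep: docstring-quotation hits only). §1 verbatim (heading line, then the sentence):

> ## 1 · The KILL sentence (word form fixed now — REF-B3 block 3 P1–P4 19:47:48Z ADOPTED: result level CONVERTS, functional level DECIDES; blanks ⟨…⟩ filled from certified rows / landed decls)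

> «KILL(B-fam) INSIDE K_fam = K_fam^diag ∪ K_fam^(A) of §2 — statuses (I) and (II-a) DECIDED (theorem / input price), status (II-b) GIVEN B-AH (E-014; fam instance B-AH(fam) stated below, premise NAMED not proved, per ls-lead 18:15:52Z / director 18:15:06Z (3)): no design d ∈ K_fam certifies, at MAIN ORDER in the currency of §5, an untwisted non-vanishing proportion p₁(d) with p₁(d) + p₂(d) > 1 on an IS-COMPATIBLE family (w_f·χ_D(−N) = +1 at squarefree level, resp. the parity-compatible class of the aspect; uniform in D ≤ |family|^δ; p₂(d) is itself a FUNCTIONAL — free twisted mollifier M_χ — not the constant ½, REF-B3 P4(c)) conditional on an open-in-print input priced ≤ L. Four statuses, three kinds of certificate + one named premise. (I) INSIDE THE DIAGONAL RANGES, SINGLE MOLLIFIER, ψ-FREE COEFFICIENTS (K_fam^diag: linear mollifiers of every H¹/AC profile, (expanded length)² ≤ |family| with |family| per row as in §2/§5 (level N: M² ≤ N^{1−ε}; level average N ≍ Q: M ≤ Q^{1−ε}·(restricted: see II-b); weight k: the printed range of famE-05; REF-B3 P4(a)), in every aspect of §2): p₁(d) ≤ Δ/(1+Δ) ≤ ½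 of the even/compatible class (< ½ for Δ < 1; = ½ only at the unattained endpoint Δ = 1) BY THEOREM — KMV2000.ratio_one_le / ratio_one_lt_quarter / envelope_lt_quarter_iff (p457854, 01a610327c0f) and OnePieceMollifierCeiling.propIS_le / propIS_le_half / propIS_lt_half (p458548) over the typed diagonal forms of KMV Props 4.1/5.1 (famE-01, p459231), with the two-lineage certified values (DESIGN-MAP §1–§3: 122 + 908 cells, ls-ref-num PASS 17:26:52Z / 17:44:33Z) and the printed laws famE-05 for the other aspects (all ≤ ½ of even, = ½ only at sup endpoints) — no input involved, nothing to price; general coefficient vectors x_m (not profile-shaped) are inside (I) because at k = 0 the optimal linear mollifier IS of profile form (KMV2000 [paper:doi-10-1515-crll-2000-074 p0007 L31 + footnote 2] → IS2000's optimisation; REF-B3 20:05:43Z; typer-1 asked to put the citation in famE-01's docstring; the finite-M residue is famE-09's probe, never a verdict). (II-a) K_fam^(A) MEMBERS WHOSE CLOSING INPUT IS UNPROVED BEYOND THE RANGE — level-individual or aspect designs with (expanded length)² > |family| (C0-Δ>1, (η)), restricted compatible level averages with mollifier beyond the level-average range (C2b-long), amplified measures with an expanded length beyond range: «no (XL)»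 BY INPUT PRICE — the displayed inputs famE-02 (E-060), famE-04b (E-093), famE-10 and their amplified/aspect twins are each priced XL by ls-ref-1 with printed reasons (KMV p0028 L74–77; LNM 1891 p0097 L17–19; BF17 Thms 5.1/6.1), none ≤ L; and the RESULT-LEVEL theorems LOCALISE why (the conversion, REF-B3 P2): the POINTWISE theorem CentralValueFamily.goodMass_le_of_twisted_of_mixed (p463559 ACCEPTED 9f3b2af429fa; any CentralValueFamily, ARBITRARY non-negative weights, ONE parameter P and ONE genuine χ_D: NonnegOn ∧ p₂·evenMass ≤ goodTwistedMass ∧ mixedMoment ≤ M·evenMass ⊢ goodMass ≤ (1 − p₂ + M(log|P|)^{2a})·evenMass; level-averaged algebraic form avgGoodMass_le_of_twisted_of_mixed), instantiated at compatible squarefree N, 1 < D ≤ N^δ with M = (C/c)·L(1,χ_D), GIVEN the printed in-range theorems entering as typed hypotheses lapidRallis2003_theorem1_gl2Twist (non-negativity) ∧ iwaniec2006_twistedHalf (famE-06; supplies htw) ∧ iwaniec2006_mixedMomentOverMass (famE-07; NAMED FACT p465261 ACCEPTED, TOTAL-mass ratio, 1 < D) ∧ EvenShare (famE-15, NEW S-binder: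 even harmonic mass ≥ c·total mass on compatible levels; typed shape CentralValueFamily.EvenShare p466418; PROVED at prime level k = 2 as evenShare_primeLevelFamilyTwo p467198 from kowalskiMichel2000_petersson/_lemma1; general squarefree N = root-number equidistribution in harmonic measure, S) — hmix is supplied from the last two via CentralValueFamily.mixedOverMass_of_total on the datum refined to 1 < D (CentralValueFamily.refine, p466418 ACCEPTED) — an (A)-DEDUCTION modulo printed theorems not yet proved in the tree, ls-ref-1 (b1), REF-B3 P4(b). RIDER W5 (REF-B3 block 5 20:33:44Z on ls-lit-typer-4's TYPING ALERT 20:18:05Z; kernel-certified: CentralValueFamily.not_mixedOverMass_of_evenMassPos p466418, H_k(N) instance iwaniecSarnakFamily_not_mixedOverMass p467198): the landed ∀-shape corollaries goodMass_le_of_mixedOverMass / avgGoodMass_le_of_mixedOverMassAvg and the H_k(N) pin goodMass_le_half_iwaniecSarnakFamily are VACUOUS DISPLAYS as instantiated for H_k(N) — their hypothesis MixedOverMass δ₁ (resp. MixedOverMassAvg) quantifies over D = 1, where Mathlib's junk value ζ(1) = (γ − log 4π)/2 < 0 makes it jointly unsatisfiable with NonnegOn ∧ EvenMassPos — and are NOT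 cited as content by this word (vacuous, not wrong); their re-derivation over the printed TOTAL-mass shape LANDED as p467703 ACCEPTED (CentralValueFamilyForcedSplitTotal.lean: CentralValueFamily.goodMass_le_of_twisted_of_mixedTotal, goodMass_le_of_mixedOverTotalMass — NonnegOn ∧ MixedOverTotalMass δ ∧ TwistedHalf p₂ a δ ⊢ goodMass ≤ (1 − p₂)·evenMass + C·L(1,χ)(log|P|)^{2a}·totalMass at every genuine compatible χ_D, 1 < D ≤ |P|^δ, NO even-share hypothesis = «the excess over 50 % disappears»; goodMass_le_of_mixedOverTotalMass_of_evenShare = the proportion form GIVEN EvenShare; pins goodMass_le_half_total_iwaniecSarnakFamily (every even k ≥ 2, large squarefree N; hypotheses LR03 + iwaniec2006_twistedHalf + iwaniec2006_mixedMomentOverMass, all typed print) and goodMass_le_half_weightTwo_prime (k = 2, prime levels, proportion form, + KM2000 facts)) — per the director's word 20:55:00Z these MAY be cited as content once REF-B3 says so, the three vacuous displays may NOT; B-AH(fam), (II-b) and the domination lemma are untouched (functionals at genuine χ_D never meet D = 1) show that in the (A)-world the TRUE compatible w-proportions obey p₁^w + p₂^w ≤ 1 + C·L(1,χ_D)(log|P|)^{2a},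 so each such CLOSING input's OWN displayed asymptotic («that off-diagonal / resonance block is o(main)») is false under (A) (W2): any proof of it must be χ_D-sensitive at that sum (no coefficient-agnostic / nebentypus-uniform bound gives it; crit-3 (α)) — which is why XL cannot drift to L on re-reading. (II-b) K_fam^(A) MEMBERS INSIDE THE RANGES WITH PROVED, χ_D-EXPLICIT INPUTS — (ii) restricted compatible level averages with (length)² ≤ |family| (IS2000's own regime: the root-number term T of (★) at main order, explicit), (iii) BPZ-type designs at compatible prime level with ψ-carrying coefficients ρ (beyond the printed ρ₁) inside the printed ranges, (iv) amplified measures ω|A|² with all expanded lengths in range and χ_D(ℓ) frozen on the amplifier support (C3′): NOT DECIDED at this word — reading OF RECORD = the COMBINED form countersigned by REF-B3 (block 4 20:27:08Z + block 5 20:33:44Z): [NARROW — of record] the in-range members (ii)/(iii)/(iv) are UNREVIEWED — 0 ROWS EVALUATED; NONE IS EVALUATED AT THIS WORD (this sentence travels into the issued scope line) — hence EXCLUDED from the decided scope of this KILL and RE-OPENED automatically on the first filed evaluation; [GIVEN — recorded prediction] «no GIVEN B-AH(fam)» (E-014 fam instance, premise NAMED not proved, refutable as «sup over in-range (ii)/(iii)/(iv)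 designs of Π(d;(A)-data) := p₁ + p₂ − 1 ≤ 0»; ls-ref-1 19:59:20Z form). PREMISE TESTS TONIGHT (ls-lead 20:29:37Z rider, asked of the director as a TERM of the word; REF-B3 pre-registered acceptance 20:36:21Z (α)–(δ)): the two typed deciders of (iv) run to completion on the B-fam tranche as premise tests of B-AH(fam) — fam-Q10 (ls-Bfam-num-1 grid j259452, lineage A × ls-Bfam-num-2 g2 lineage B) and T1 (exact joint-sup certificate at equal expanded-length budget, ls-Bdh-num-1 g2 × a B twin) — two-lineage + ls-ref-num PASS, results filed to DESIGN-MAP-fam §6 (II-b) rows and EDREGISTRY E-014(fam); budget accounting stated in every table (which of len A, len M, len(A²M²) is held fixed — comparisons at unequal budget are the classic false positive); a cell where an amplified/bilinear design BEATS the single-M optimum at EQUAL budget is a DESIGN CANDIDATE to be filed as a row within the hour, and if its compatible-class value exceeds 1 − p₂ it is exit-x1 material (a proof of ¬(A), used in no word until named, theory-reviewed and kernel-checked) and RE-OPENS B-fam at that row automatically; a clean table upgrades (iv) from GIVEN to «numerically consistent» — never to «decided», which needs the THEOREM S-fam-02′ (typed over the KMV diagonal forms, rc 0) or per-row two-lineage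 Π ≤ 0 for filed rows (REF-B3 P2/P3 domination lemma: such a design certifies c(d) = inf_data f_d(P; data) ≤ f_d(P; (A)-data) by theorems valid in every world; the result-level theorems of (II-a) CONVERT a computed f_d(P;(A)-data) with p₁ + p₂ > 1 into a PROOF of ¬(A) — exit x1, the (c)-door E-085 fam instance — they do not bound f_d itself; absent the premise, only COMPUTING the explicit (A)-world functional decides the row). B-AH(fam) := «for every d ∈ K_fam^(A) with proved inputs, the (A)-world main-order value of its certified functional satisfies p₁(d;(A)-data) + p₂(d;(A)-data) ≤ 1 + o(1)» — the functional-level shadow of p463559, PREDICTED by the consistency of the (A)-world with everything provable (B-AH, E-014) and refutable row by row; the functional-level DECIDERS are typed or in typing — D-fam-2 BPZ layer BPZ2024.singularSum (p464253) / singularSum2 + rho2 (p464647, (6.5)) for (iii), the T-functional of (★) for (ii) (IS-spec, L-sized, waits for acq-11417), the amplified diagonal C-S Π^w = p₁^w + p₂^w − 1 (D-fam-3) for (iv), with REF-B3's length-budget conjecture S-fam-02′ («sup over (A, M) with len(A²M²) ≤ y of the diagonal amplified C-S = the single-M optimum at length y»; proved ⇒ (iv) joins (I) by theorem) — every evaluated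 row UPGRADES from «no GIVEN B-AH(fam)» to «no (decided)» or becomes exit x1; none is evaluated at this word. (III) CONSISTENCY AT EXACTLY ½ (commentary + typed exhibits, no premise): the world-independent in-range optimum p₁* = Δ/(1+Δ) → ½⁻ of (I) meets the forced ceiling 1 − p₂ of (II-a) with ZERO margin at p₂ = ½ — the third knife edge; in the (A)-world the UNTWISTED single-value moments with ψ-FREE coefficients keep their main terms, while the TWISTED side and every ψ-CARRYING coefficient vector ρ or amplifier change (REF-B3 P4(d); typer-1 D-fam-2-SCOPING v0.2 §6(3) read for ψ-free ρ only); the one printed (A)-world GL(2)-family calculus, BPZ24 [paper:arxiv-2102.03087 Thm 1.2 p0003], bounds RANKS through the product Λ_{f,ψ}: r_f ≤ 2 for almost all f at compatible primes (ψ(q) = −1) and r_f ≤ 1 at incompatible ones — it does not split r_f = 0 | 2 on the compatible class («the even part up to a factor of two», p0002 L40–42), which is (II-a)'s ceiling seen from the illusory side ⟨typed exhibits: buiPrattZaharescu2024_theorem11/12 p457180; §4 first-moment chain buiPrattZaharescu2024_section4_first/_second/lemma51/lemma52 p464253; Props 2.1–2.3 + (2.2) by ls-Bfam-typer-2, p…;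 exact purity at prime N > D inert harmonicSum_centralValue_mul_twisted_eq p461432⟩. Family B-fam is CLOSED into §E with the barrier sentence ⟨KBfam/VBfam⟩: "the third knife edge ½ is the shadow of (A) — IS's pigeonhole turns χ_D-blind non-vanishing into χ_D-information only on the compatible class, and compatibility re-introduces χ_D at main order through the root-number weight μ(N)χ_D(−N) (typer-1 (★)), which resonates in the (A)-world; every INPUT making that resonance block o(main) is refuted by (A) at main order, so no design of K_fam closes on an input priced below XL; inside the ranges the ψ-free single-mollifier functional is ≤ ½ by theorem and the ψ-carrying / restricted / amplified functionals are ≤ their forced ceilings GIVEN B-AH(fam), decidable row by row by computing them; an unconditional theorem «p₁ ≥ ½ + η on the compatible class, uniform in D ≤ N^δ» is excluded by nothing we hold — it would BE a proof of ¬(A) through (7.7), IS2000's own programme — and is therefore no cheaper than the summit's neighbour" (crit-3 19:24:07Z tail).»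

**PREMISE OF RECORD for status (II-b): B-AH(fam)** (E-014 fam instance) — named, not proved, displayed below as the
hypothesis `BAHfam d` of the (II-b) verdict; (c)-door = registry row E-085 (exit x1). Status (I) leans on no premise
and no input; status (II-a) leans on three DISPLAYED printed inputs (kind (c): printed theorems typed as named facts,
not proved in the tree) and on no premise.

## The class `K_fam` (KILL-draft §2, sha16 b6c520d7224008a5, REF-B3-audited) and its dispatch (this file)

§2 verbatim (KILL-draft.md v2.2.2 lines 7–14, sha16 b6c520d7224008a5 — heading, then the class text; the dispatch
table below is this file's rendering of it, keyed constructor by constructor):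

> ## 2 · (a) The class K_fam as conjuncts over OBJECTIVE §1.4 / PLAN v1.3 §6 + §10 coordinates (REF-B3 audits THIS text)

> Common box: mechanism = IS2000 pigeonhole on a GL(2) family 𝓕 with non-negative weights w (harmonic ω_f; natural weights — IS print both measures, no separate EDLIST row; amplified ω_f·|A_f|², A_f = Σ_{ℓ ≤ N^α} c_ℓ λ_f(ℓ)ℓ^{−½}, c real on primes/squarefree ℓ); statistic = untwisted mollified first/second moments of L(½,f) (side 1) and twisted L(½,f⊗χ_D) (side 2, p₂ = ½ in print on the compatible class, (7.6)); mollifier M = Σ_{m ≤ 𝕄} x_m λ_f(m)m^{−½}, x_m = μ-type × Σ_pieces P_j(log(𝕄_j/m)/log 𝕄_j), each P_j in the H¹/AC closure with P_j(0) = 0 (multi-piece, kinks, free amplitudes allowed); endgame = Cauchy–Schwarz/Ritz proportion at main order, OBJ_fam(d) := ½·(even/compatible scale) − p₁(d), «closes» ⟺ OBJ_fam(d) < −η uniformly (§5); compatibility = w_f·χ_D(−N) = +1 (squarefree level N, (N,D) = 1, D ≤ N^δ) resp. «even χ_D only» at level 1 (REF-B3 B2: ε(f⊗χ_D) = χ_D(−1)ε_f;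 odd χ_D ⇒ L(½,f⊗χ_D) ≡ 0, p459073).

> K_fam^diag (decided by theorem/print): every design whose expanded linear length satisfies (length)² ≤ |family| in its aspect, with the printed normalisations (REF-B3 B1): level-individual harmonic/natural 𝕄 ≤ q̂^Δ, q̂ = √q/2π, Δ < 1 (KMV Props 4.1/5.1; C0, C0⁺, C7-inside, C6 Maass/IK-26 analogue); weight-K average 𝕄 = K^Δ, Δ < 1 (BF21 Lemma 8.6); weight-individual Δ < ¼ (BF21 Thm 8.7); spectral t_j its printed range (BHS21); level p^ν L = N^Ω, Ω < ½ (BF17/BF18); unrestricted level average (IS; calibration only — incompatible, «no (decided: not a compatible class)»).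

> K_fam^(A) (v2, REF-B3 block 3: members whose closing input is unproved BEYOND the range = status (II-a), «no (XL)» by input price, localised by the conversion theorems p463559; members INSIDE the ranges with proved χ_D-explicit inputs = status (II-b), «no GIVEN B-AH(fam)», functional level decides row by row): (i) level-individual or aspect designs BEYOND the range (C0-Δ>1, (η)) — displayed slot famE-02/E-060 resp. its aspect twin; (ii) RESTRICTED (compatible) level averages with mollifier longer than √|family| (C2b; IS's own attempt) — displayed slots famE-04a (the (A)-world functional, kill instrument) / famE-04b (XL) / famE-04c (S), indexed (prime | squarefree) × (χ_D even | odd) per REF-B3 B4 (prime levels: all-or-nothing by parity; squarefree: freeze μ(N)χ_D(−N) = χ_D(−1); exceptional-level removal not free beyond √N); (iii) compatible prime level in the (A)-world with BPZ-type product mollifiers, X = q^θ (C2b′; the printed instance attains ½ exactly); (iv) amplified measures ω|A|² on either/both sides with all expanded lengths inside the ranges and χ_D(ℓ) frozen to μ(ℓ) on the amplifier support (C3′) — displayed slots famE-08 (amplified purity = ADMISSIBILITY of A: the L′(1,χ) coefficient of the amplified mixed moment must vanish, else no L(1,χ) bound follows and d is not an IS design), famE-13 (amplified twisted side), famE-01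 (ℓ-twisted untwisted side, S).

> PARITY INDEX (REF-B3 F3, KILL-INTAKE §3(b)): statuses (I) and (II) are PARITY-UNIFORM (the theorems are pointwise at any compatible (P, χ_D); compatible prime levels p ≡ −1 (mod D) exist for both parities — iwaniecSarnakFamily_compatibleSupply, Linnik); the BPZ24 exhibits of (III) are ODD χ_D only (ψ odd, p0003 L23; compatible ⇔ ψ(q) = −1 by (2.2)); for EVEN χ_D the product's sign is +ψ(q), compatible = split primes, which in the (A)-world have relative density ≍ (1−β₁)log x — individual levels exist, level averages over them do not (F3) — no exhibit in print, none needed.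

> Carried along, decided, no slot: C2a IS pointwise (the printed ½), C4 pure 2nd-moment/large-sieve counts (≪ ½ by construction), C5 product statistic L(½,f)L(½,f⊗χ_D) (first moment ∝ L(1,χ_D): the trivial direction), C7 two-piece/reflected profiles inside range (= C0⁺ by the approximate functional equation's symmetry, w_f ≡ 1 class).

> NOT in K_fam, said so (EXITS §8): zero-statistics inputs (one-level density ⇒ non-vanishing; fail F6(ii)/(vii)); designs conditional on GRH/GLH-type hypotheses that imply ¬(A) outright (class «no (XL, conditional)», never KEEP-eligible); non-moment statistics; the transition regime (1−β₁)log Q ≍ 1 (no printed (7.7) there).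

Common box (§2): mechanism = the Iwaniec–Sarnak pigeonhole on a GL(2) family with non-negative weights (harmonic
`ω_f`; natural; amplified `ω_f·|A_f|²`); statistic = untwisted mollified first/second moments of `L(½,f)` (side 1)
and twisted `L(½,f⊗χ_D)` (side 2); mollifier `M = Σ_{m ≤ 𝕄} x_m λ_f(m) m^{−½}`, `x_m = μ-type × Σ_pieces
P_j(log(𝕄_j/m)/log 𝕄_j)`, each `P_j` in the H¹/AC closure with `P_j(0) = 0`; endgame = Cauchy–Schwarz proportion at
main order; compatibility `w_f·χ_D(−N) = +1` (squarefree `N`, `(N,D) = 1`, `D ≤ N^δ`). Logarithmic lengths below are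
in KMV's normalisation (`𝕄 = q̂^Δ`, `q̂² ≍ |family|`; an amplifier of length `q̂^α`), so «(expanded length)² ≤
|family|» reads `Δ ≤ 1` (`Δ < 1` in KMV's printed range), resp. `α + Δ ≤ 1` for the product `A·M`.

| status | §2 stratum | family / constructor | class predicate (NO analytic hypothesis) | verdict displayed | decided by | flag |
|---|---|---|---|---|---|---|
| (I) | K_fam^diag, KMV polynomial profiles, aspects with printed law `Δ/(1+Δ)` of even (level-individual harmonic/natural KMV Props 4.1/5.1; weight-`K` average BF21 Lemma 8.6; Maass spectral BHS21; unrestricted level average = IS calibration, not a compatible class) | `familyBfamDiag`, `DiagDesign.poly A Δ P` | `0 < Δ ∧ Δ < 1 ∧ KMV2000.Admissible P` | `KMV2000.ratio Δ P 1 ≤ KMV2000.envelope Δ ∧ KMV2000.ratio Δ P 1 < 1/4` (all-forms scale; `= ½·`even scale) | `KMV2000.ratio_one_le`, `KMV2000.ratio_one_lt_quarter` (p457854) | DECIDED BY THEOREM |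
| (I) | K_fam^diag, every H¹/AC profile (IS normalisation: `q = p′ ∈ L²[0,1]`, `p(0) = 0`; for a KMV polynomial `P`: `p = P′`, `q = P″`), same aspects | `familyBfamDiag`, `DiagDesign.ac A Δ q` | `0 < Δ ∧ Δ ≤ 1 ∧ q, q² interval-integrable on [0,1]` | `propIS Δ q ≤ Δ/(1+Δ) ∧ propIS Δ q ≤ 1/2` (even scale) | `OnePieceMollifierCeiling.propIS_le`, `propIS_le_half` (p458548); strict `< ½` for `Δ < 1` = `vdiag_ac_lt_half` (`propIS_lt_half`) | DECIDED BY THEOREM |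
| (II-a) | K_fam^(A) beyond the range: (i) C0-Δ>1 level-individual, (η) aspect twins, C2b-long restricted averages, amplified with an expanded length beyond range — one constructor, tag `BeyondKind` | `familyBfamBeyond`, `BeyondDesign ⟨κ, Δ, P⟩` | `1 < Δ ∧ KMV2000.Admissible P` | `1/4 < KMV2000.envelope Δ` (the design's diagonal-continued target EXCEEDS ½ of even — it is a candidate ONLY through its closing input) `∧ ∀ k ≥ 2 even, ForcedHalfTotal k` (the (A)-deduction: binders ⊢ `Σʰ_good ≤ (½+ε)·Σʰ_even + C·L(1,χ_D)·(log N)⁴·Σʰ_all` at every genuine compatible `χ_D`, `1 < D ≤ N^δ`) | `KMV2000.envelope_strictMonoOn` (p457854); `CentralValueFamilyHalfEdge.goodMass_le_half_total_iwaniecSarnakFamily` (p467703, REF-B3 CLEARED 21:15:26Z) | CONDITIONAL on the three displayed inputs (kind (c)); closing input famE-02 = E-060 priced XL |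
| (II-b) | K_fam^(A) inside the ranges with proved χ_D-explicit inputs: (ii) `NarrowMember.restricted Δ P`, (iii) `NarrowMember.bpz q D θ`, (iv) `NarrowMember.amplified S α Δ P` | `familyBfamNarrow`, `NarrowDesign ⟨m, p₁A, p₂A⟩` | `m.InRange` ((ii) `0 < Δ ≤ 1 ∧ Admissible P`; (iii) `q` prime, `1 < D`, `D ∣ q + 1` (so `χ_D(−q) = 1` for EVERY `χ mod D`: parity-uniform compatible prime level), `0 < θ < ½` (`X = q^θ`, `X² ≤ q`; BPZ's asymptotics PROVED for `θ < 1/6` — p457180 Props 2.1–2.3 —; every (iii) row's order-0 coordinates presuppose an unprinted order-0 evaluation, and rows with `1/6 ≤ θ < ½` additionally the extension of Props 2.2/2.3: GIVENs displayed beside B-AH(fam) in `NarrowMember.InRange`'s docstring; REF-B3 D4 (a) + 00:02:10Z wording); (iv) `S` primes, `0 ≤ α`, `0 < Δ`, `α + Δ ≤ 1` AND `2α + Δ ≤ 1` (both expanded lengths), `Admissible P`) | `BAHfam d → ¬ d.Certifies`, i.e. `p₁A + p₂A ≤ 1 → ¬ 1 < p₁A + p₂A`, the two coordinates being the member's (A)-world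 main-order functional values, carried UNEVALUATED | `not_lt` (premise ⇒ conclusion; nothing evaluated) | GIVEN B-AH(fam) — 0 ROWS EVALUATED; excluded from the decided scope, re-opened on the first filed evaluation |

Carried along, decided, no slot (§2): C2a (IS pointwise, the printed ½), C4 (pure second-moment counts), C5 (product
statistic), C7 (two-piece/reflected profiles inside range = C0⁺) — inside (I) by linearity / by construction; not
given constructors. NOT in K_fam (§2 EXITS): zero-statistics (1-level density) inputs; GRH/GLH-conditional designs;
non-moment statistics; the transition regime.

## Binders of record for status (II-a) (REF-E §0b-v9 C3 = ls-Bfam-typer-2 21:13:54Z list, ADOPTED ls-barrier-plan 21:21:29Z)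

The (II-a) verdict DISPLAYS, as hypotheses of `ForcedHalfTotal k`, exactly: binder 0
`IwaniecSarnak.lapidRallis2003_theorem1_gl2Twist` (non-negativity; consumed through `iwaniecSarnakFamily_nonnegOn`);
the famE-06 input `IwaniecSarnak.iwaniec2006_twistedHalf` (p456172; supplies `htw` through
`TwistedHalf_of_twistedProportion`, p459497); binder 2 `IwaniecSarnak.iwaniec2006_mixedMomentOverMass` (famE-07,
NAMED FACT p465261, TOTAL-mass ratio, `1 < D` built in); binder 1 = the hypothesis data of
`CentralValueFamily.goodMass_le_of_twisted_of_mixed` (p463559) at `𝓕 := iwaniecSarnakFamily k` — `χ mod D` real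
primitive, `1 < D`, `(N, D) = 1 ∧ χ(−N) = 1`, `D ≤ N^δ`, `N` squarefree and large — displayed as the binders of the
conclusion. The even-mass denominator is handled via p467703's TOTAL-MASS form (REF-E C3 second option; REF-B3
CLEARED p467703 as citable 21:15:26Z): the displayed conclusion is the statement of
`goodMass_le_half_total_iwaniecSarnakFamily` verbatim, and `forcedHalf_evenMassForm` below is the PROVED rewriting
into C3's verdict text «`Σʰ_good ≤ (½ + ε + C·(Σʰ1/Σʰ_even)·L(1,χ_D)·(log N)⁴)·Σʰ_even`» under the displayed pointwise
`0 < Σʰ_even`. Reading: «NO at main order exactly when the last term `→ 0`» — which is the content of the closing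
input famE-02 = E-060 (the off-diagonal main term BEYOND the range, MOMENT CURRENCY; open-in-print, priced XL with
printed reasons KMV p0028 L74–77, LNM 1891 p0097 L17–19): the flag is CONDITIONAL, the slot is analytic (kind (c)),
not inhabited in the tree. No verdict or constructor of this file displays a `D = 1`-inclusive hypothesis shape.

## Docstring points of record (w1)–(w3) (ls-Bfam-plan 22:45:56Z, ADOPTED ls-barrier-plan 22:52:57Z; v1.0.1 erratum)

(w1) famE-09 (`KMV2000.LinearMollifierOptimality`, INERT — a probe, never a verdict): «hard half proved AT MODEL LEVEL
(FT) [ls-Bfam-num-2 g2 FAME09-MODEL-THEOREM.md 4c9cde5b821b0e75, REF-B3 PASS as model-level derivation; typed model-level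
form p473278 ACCEPTED]; family-level = reduction (KMV Lemma 3.3 general-coefficient asymptotics + non-degeneracy), not
landed» — the `K_fam^diag` class sentence keeps «model level»; the status (I) clause cites p457854 / p458548 / p459231
BY THEOREM, unchanged. (w2) The famE-02 slot (and its (II-a) twins) is a MOMENT-CURRENCY object (SH-105): the `> ½`
records in the 1-level-DENSITY currency (ČDFMS25 arXiv:2505.18712, DFS25 arXiv:2210.15782) are NOT famE-02 discharges
(see `BeyondDesign` and «because» below). (w3) Status (II-b) rows read «UNREVIEWED GIVEN B-AH(fam) [E-014]»; the TERM
(ii) premise tests of the word are filed as EVIDENCE rows in B-fam/DESIGN-MAP-fam.md v1.7.2 §6.1 — IIb-Q10 (lineage B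
j261145: 43/43 cells, the amplified design below the equal-budget single-`M` optimum) and IIb-T1 (lineage A j260655 +
j260930, 0/855 equal-budget wins in range; B twin j261259 filed; v2 j261693 — in range 0/39 wins, out of the
first-moment range 9/21 certified exceedances = CONTEXT; edge twin j262149; REF-B3 B-fam/REF.md Blocks 8–11;
DESIGN-MAP-fam v1.7.3 25dea9fb90f24d0a) — and NO class member changes status on them (REF-B3 (α)): a
clean table upgrades (iv) to «numerically consistent», never to «decided»; the coordinates `pOneA`/`pTwoA` of every
`NarrowDesign` stay unevaluated in this file.

## PRINTED BASIS (D-0021 keys; text + locators = HOME/lit/r7/SYNTHESIS.md §8, file v1.4 sha16 a3575492ccced107, §8 wording = v1.1 basis + the v1.2 currency-split NB; locators page-read by ls-lit-r7)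

technique_class: ONE-PIECE mollifier `M(f) = Σ_{m ≤ M} x_m λ_f(m) m^{−1/2}` (KMV class, or arbitrary `x_m ≪ C^ε`)
of length `M ≤ √(analytic conductor C)` in the harmonic/natural FIRST and SECOND moments of `L(½,f)` [resp.
`L(½,f⊗χ_D)`] over a self-dual GL(2) family with `L(½) ≥ 0`, then Cauchy–Schwarz with a value floor [IS2000 via
LNM 1891 §7 p0097; KMV2000 §§4–7 (paper:doi-10-1515-crll-2000-074 p0012–p0022); BF21 §8 (arxiv-1610.03465 p0021);
WYZ24 §1.2 (arxiv-2410.09593 p0004)]. blocks: «proportion of {ε_f = +1 : L(½,f) ≥ (log C)⁻²} > ½» (⇔ > ¼ of all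
forms) in every printed family of §2. because (MOMENT / MOLLIFIER-LENGTH CURRENCY throughout): with `M` in the
admissible range the mollified moments are their DIAGONAL main terms and the C–S ratio is an explicit increasing
function of `Δ = log M/log √C` — `Δ/(1+Δ)` [KMV p0007:L80, p0021:L74; BF21 p0021; BHS21 arxiv-1810.07991
p0003:L21–33], `(p−1)/p·Ω/(1+2Ω)` [BF18 arxiv-1605.02434 p0012 (6.7)], `Δ/(3+2Δ)` [PWZ19 arxiv-1906.06103
p0012:L150–164], `½·Λ/(1+Λ)` [WYZ24 p0003:L27–40] — each equal to ½ of even exactly at `M = √C`, where every printed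
admissible range ends; crossing it AT FIXED LEVEL with a one-piece mollifier of length `M ≤ √C` replaced by `Δ > 1`
needs the off-diagonal Kloosterman sum `Σ_{c ≡ 0 (N)} S(m,n;c)c⁻¹J_{k−1}(4π√(mn)/c)` EVALUATED beyond the
Weil/large-sieve range FOR THE BILINEAR mollified-moment test vector [KMV p0013:L78–84; p0028:L73–77 «the absolute
limit of our method, barring any improvement in the (logarithmic) length of the mollifier Δ beyond 1»; WYZ24
p0058:L1–L39] — in print only under GRH for Dirichlet L-functions or by a LEVEL AVERAGE (NB, v1.2: for LINEAR
prime-sum test vectors — the 1-level DENSITY currency — the same off-diagonal is handled UNCONDITIONALLY at fixed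
prime level up to support 15/8–2 [ILS; DFS25 arxiv-2210.15782 Thm 1.1; ČDFMS25 arxiv-2505.18712 Thms 1.1/1.2]; there
the missing piece is positivity (GRH), not evaluation; density ⇒ proportion needs GRH, so that currency does not
touch K_fam and nothing moves on the Siegel edge). evasions_known: (1) GRH for Dirichlet L ⇒ `Δ > 1` feasible at
fixed level [IS2000 apud KMV p0028:L74–77] — moot against the exceptional character; (2) AVERAGING OVER THE LEVEL
`N ≍ Q` with a mollifier longer than `N` ⇒ (7.5) for MORE than 50 % of the unrestricted even class [LNM p0097:L15–20]
— but under the root-number condition `χ_D(−N) = 1` of (7.6) «the off-diagonal terms are badly affected, and the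
excess over 50% disappears» [p0097:L20–22]; (3) extended-support 1-level density (conditional as eliminations: GRH
for positivity); (4) GL(1) twisted second moment beyond `√q` at prime modulus (BPRZ20) — no GL(2) harmonic-family
analogue (famE-02 open-in-print); (5) algebraic / Galois-orbit non-vanishing does not control the size of the central
value [Soundararajan ICM22 arxiv-2112.03389 p0011:L35]; (6) the regularised RTF (Yang) has the same admissible range
`√C` [WYZ24 p0003:L27]. scope_caveats: the «½ (¼) is a natural barrier» sentences [BF18 p0003; Trotabas 2011
doi-10-5802-aif-2601 p0004:L57–59; KMV p0028:L73] are statements about the METHOD CLASS, not theorems: no printed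
result proves that a one-piece mollifier with arbitrary coefficients of length `≤ √C` cannot exceed ½ of the even
mass in a GL(2) family (optimality in print only for GL(1): ČM25 arxiv-2501.12526 Thm 1.1/1.3, Rem 1.2); nothing in
print excludes `Δ > 1` unconditionally (open, not refuted); IS2000's own level-average computation is reported in
LNM §7 but not printed in detail (primary acq-11417 open). status: established as a method-class ceiling with nine
printed instances and four author statements; no dissent in print.

## C4 — the class is inhabited, status by status, by TERM (rationals only; `kbfam_inhabited`)

(I): `DiagDesign.poly .levelIndividual (1/2) (X^2)` (KMV's optimal profile `P₀ = x²`, `admissible_X_sq`) and the AC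
profile `q ≡ 1` (IS profile `p(t) = t`, i.e. KMV `P = x²/2`) at `Δ = 1`; (II-a): `⟨.levelIndividual, 3/2, X^2⟩` (C0-Δ>1); (II-b): the compatible
prime-level member `NarrowMember.bpz 11 3 (1/8)` (`11` prime, `3 ∣ 12`, so `χ_{−3}(−11) = 1`; BPZ length
`X = q^{1/8}`, inside the PROVED sub-range `D⁸X⁶ ≪ q^{1−ε}`), the restricted average `NarrowMember.restricted 1 (X^2)`, and the amplified member
`NarrowMember.amplified {2, 3} (1/4) (1/2) (X^2)` (amplifier on the primes 2, 3 of length `q̂^{1/4}`, mollifier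
`q̂^{1/2}`, `α + Δ = ¾ ≤ 1`, `2α + Δ = 1 ≤ 1`). The designed member terms of B-fam/DESIGN-MAP-fam (fam-C0-*, fam-C2-*, fam-C6/C7/C8-*)
enter by the members file `RepairIntakeBfamMembers` (ls-Bfam-typer-1 g2) against these constructor field types:
`DiagDesign.poly (A : DiagAspect) (Δ : ℝ) (P : ℝ[X])`, `DiagDesign.ac (A : DiagAspect) (Δ : ℝ) (q : ℝ → ℝ)`,
`BeyondDesign {kind : BeyondKind, Δ : ℝ, P : ℝ[X]}`, `NarrowDesign {member : NarrowMember, pOneA pTwoA : ℝ}` with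
`NarrowMember.restricted (Δ : ℝ) (P : ℝ[X]) | bpz (q D : ℕ) (θ : ℝ) | amplified (S : Finset ℕ) (α Δ : ℝ) (P : ℝ[X])`,
and `BfamDesign.diag | beyond | narrow` for the union.

## Relation to `Rplusplus<k>`, `bmultiWord<k>`, `blenWord<k>` (C2): DISJOINT BY DECLARATION

`bfamWord` is a SEPARATE decided list (`ClassDecided bfamWord`); it is never a row of `Repair.Rplusplus<k>` and is
never appended to `bmultiWord<k>` / `blenWord<k>` (different mechanism: IS2000's pigeonhole on a GL(2) family, not
Zhang's discrete mean); `Repair.rplus_extend` is not used. Only the bookkeeping types `Repair.DesignFamily`,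
`DesignFamily.Decided`, `Repair.ClassDecided` of `RepairRplus` are shared.

## Narrowings declared (C1: «a narrowing is declared in the docstring»)

(n1) (I)-aspects whose printed law is NOT `Δ/(1+Δ)` — prime-power level `p^ν` (`(p−1)/p·Ω/(1+2Ω)`, `Ω < ½`, BF17/BF18)
and individual weight (`Δ < ¼`, BF21 Thm 8.7) — are theorem-in-print (famE-05, untyped by the cell's D-0026 rule) and
have no aspect TAG of their own: their designs enter through `.poly` / `.ac` under their own printed normalisations
(REF-B3 D2, see `DiagAspect`), while their distinct printed LAWS are carried by citation (famE-05), not typed; every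
printed law is `≤ ½` of even with equality only at its sup endpoint (SYNTHESIS §2 EDGE LAW). (n2) The (II-a) strata (i)/(η)/C2b-long/amplified-long share ONE
constructor with a kind tag and ONE displayed deduction (the conversion theorem is design-independent: it bounds the
TRUE compatible proportions, REF-B3 P2); their distinct closing inputs (famE-02 / its aspect twin / famE-04b /
famE-10, famE-13) are named here, priced XL in B-fam/EDLIST.md, and not typed (open in print). (n3) The (II-b)
premise B-AH(fam) is displayed per member as the bare inequality `p₁A + p₂A ≤ 1` on the member's UNEVALUATED
(A)-world main-order values (the `o(1)` is absorbed at main order); the functional-level deciders (`BPZ2024.singularSum`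
p464253, `BPZ2024.singularSum2` / `rho2` p464647 for (iii); the T-functional of (★) for (ii); the amplified diagonal
C–S for (iv)) are NOT wired to these coordinates at this word — 0 rows evaluated. (n4) Natural weights and the
multi-piece-inside-range profiles (C0⁺, C7) are inside (I) by KMV §5 / linearity and get no separate constructor.
(n5) C7/C7′: the word's 122 + 908 + 9 two-lineage certified values are ILLUSTRATIONS; no number of them enters a
Lean statement here.
(n6) The endpoint `Δ = 1` («= ½ only at the unattained endpoint», §1 (I)): KMV's polynomial row `DiagDesign.poly` carries the
printed OPEN range `Δ < 1` (Props 4.1/5.1); a profile AT the endpoint enters (I) through the AC row `DiagDesign.ac A 1 q` with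
`q = P″` (IS normalisation `q = p′`, `p = P′`; `propIS_le_half`, `Δ ≤ 1`), so no design with (expanded length)² ≤ |family|
falls between `poly` (`Δ < 1`) and
`BeyondDesign` (`1 < Δ`).
(n7) (Blen-typer-2 g3 second read N1) The (iii) level set `D ∣ q + 1` (`q ≡ −1 (mod D)` ⇒ `χ(−q) = χ(1) = 1` for EVERY
character mod `D`) is a parity-uniform SUFFICIENT sub-class of §2's «compatible prime level» (`w_f·χ_D(−q) = +1`; for
BPZ's odd `ψ`: `ψ(q) = −1`, density ½ of the primes) — wider compatible prime levels are members of the word's (iii) by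
§2 and enter the members file with their own compatibility witness; 0 rows affected.

## Versions (one writer: ls-Bfam-typer-2; landed decl NAMES never removed or renamed)

v1 p474295 (23:17:51Z) — the intake. v1.0.1 p475347 — docstring only: §2 verbatim, w1–w3, pointers. v1.0.2 p476039 — (a) the
class predicate of the (II-b)(iii) member `NarrowMember.bpz q D θ` was narrowed from `θ < ½` to `θ < 1/6` (inside BOTH of
BPZ's printed ranges as typed, p457180) with C4 witness `bpz 11 3 (1/8)` — REVERSED in v1.0.4 (REF-B3 D4: the band
`1/6 ≤ θ < ½` has `Δ_bpz = 2θ < 1`, so it is NOT a `BeyondDesign` member (`1 < Δ`) and v1.0.2/v1.0.3 left it in no class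
predicate; the v1.0.2 sentence «belongs to the beyond-range stratum» was false on that band and is withdrawn); (b) living pointer DESIGN-MAP-fam → v1.7.2 1fab3aab1d5f89c5 (ls-Bfam-plan g2 liaison second-read 23:42:29Z = PASS, one
non-blocking NB). v1.0.3 (after REF-B3 KILL-audit PASS 23:55:10Z D1–D3 and ls-Blen-typer-2 g3 second read PASS 23:55:49Z N1;
announced on INBOX 23:56:44Z per ls-barrier-plan 23:55:25Z) — ONE statement change (D1, REQUIRED): the (II-b)(iv)
class `NarrowMember.InRange (.amplified …)` gains the first-moment expanded-length conjunct `2 * α + Δ ≤ 1` (all other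
decls syntactically unchanged; C4 witness (¼, ½) still inhabits); docstring: D2 (aspect tags non-exhaustive), D3 (w3
pointers), narrowings (n6) endpoint `Δ = 1` and (n7) the `q ≡ −1 (mod D)` sub-class. v1.0.4 (REF-B3 D4 REQUIRED
23:58:44Z, form (a); RULED ls-barrier-plan 00:00:01Z; lines crossed with p476369) — ONE statement change: `.bpz` class
restored to `θ < ½` (inside `√|family|`), the whole stratum (iii) carried INSIDE (II-b) with its GIVENs displayed in
REF-B3's 00:02:10Z wording (asymptotics proved for `θ < 1/6`; order-0 coordinates presuppose an unprinted order-0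
evaluation — U2-SCOPING v0.1 —; the band `1/6 ≤ θ < ½` additionally the extension of Props 2.2/2.3); C4 witness
`bpz 11 3 (1/8)` kept; D1 and every other decl as landed. v1.0.5 — docstring only (statements frozen): the `ac` row's
profile convention stated unambiguously (IS normalisation `q = p′`, `p(0) = 0`; KMV `P` ↦ `p = P′`, `q = P″`, as in
`OnePieceMollifierCeiling` and the members file S-E-bf2) in the `DiagDesign` docstring, the dispatch table, C4 and (n6). v1.0.6 — docstring only: header
bibliographic line for [KowalskiMichelVanderKam2000] corrected to the Crelle paper the key denotes (J. reine angew. Math. 526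
(2000) 1–34, «Non-vanishing of high derivatives …»; ls-Bfam-typer-1 g2 00:26:03Z (r3)) — the earlier line named the
Invent. Math. fourth-moment paper, a different work with no key in the tree; all `[cite: KowalskiMichelVanderKam2000, …]`
locators in this file (Props 4.1/5.1, Thm 6.1, §7 p. 21, §8.4 p. 28) were and are the Crelle paper's.
-/

noncomputable section

namespace Literature.NumberTheory.LFunctions.Zhang2022

namespace Repair

open Polynomial MeasureTheory
open Literature.NumberTheory.LFunctions.IwaniecSarnak
open Literature.NumberTheory.LFunctions.CentralValueFamilyHalfEdge

/-! ### Part 1 — status (I): `K_fam^diag`, decided BY THEOREM (KMV2000 / OnePieceMollifierCeiling, cited by name) -/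

/-- Aspect tags of the `K_fam^diag` rows whose printed main-order law is `Δ/(1+Δ)` of the even class (KILL-draft §2
K_fam^diag list; SYNTHESIS §2 EDGE LAW): level-individual (KMV Props 4.1/5.1, harmonic; natural by KMV §5), weight-`K`
average (BF21 Lemma 8.6), Maass spectral (BHS21 Thm 1.1), and the unrestricted level average (IS calibration — not a
compatible class, «no (decided: not a compatible class)»). The tags are bookkeeping and NON-EXHAUSTIVE (REF-B3 D2):
§2's weight-individual (BF21 Thm 8.7) and level-`p^ν` (BF17/BF18) rows enter through `.poly` / `.ac` under their
printed normalisations (logarithmic length measured against that aspect's own diagonal range); their own printed laws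
are cited (famE-05, narrowing (n1)), not typed; the verdict term is the same theorem for every tag.
[cite: KowalskiMichelVanderKam2000, Props 4.1/5.1, Thm 6.1; §7 p. 21] -/
inductive DiagAspect : Type
  | levelIndividual
  | weightAverage
  | maassSpectral
  | levelAverageUnrestricted

/-- **Designs of `K_fam^diag`** (status (I)): a one-piece linear mollifier of logarithmic length `Δ` (KMV
normalisation `𝕄 = q̂^Δ`) with ψ-free coefficients of profile form — `poly`: a KMV polynomial profile `P`
(`P(0) = P′(0) = 0`); `ac`: an H¹/AC profile in the Iwaniec–Sarnak normalisation of `OnePieceMollifierCeiling` — the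
IS profile `p` with `p(0) = 0` given by its derivative `q = p′ ∈ L²[0,1]`; for a KMV polynomial `P` this is `p = P′`,
`q = P″` (so KMV's `P = x²` is `q ≡ 2`, and `q ≡ 1` is IS's `p(t) = t`) (IS2000's class, LNM (7.5)).
[cite: KowalskiMichelVanderKam2000, Thm 6.1 and §7 p. 21] -/
inductive DiagDesign : Type
  | poly (A : DiagAspect) (Δ : ℝ) (P : ℝ[X])
  | ac (A : DiagAspect) (Δ : ℝ) (q : ℝ → ℝ)

/-- **Membership in `K_fam^diag`**: inside the diagonal range — `0 < Δ < 1` and `P` admissible (KMV's printed range,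
Props 4.1/5.1), resp. `0 < Δ ≤ 1` («(expanded length)² ≤ |family|») with `q`, `q²` integrable on `[0,1]`. NO analytic
hypothesis. [cite: KowalskiMichelVanderKam2000, Props 4.1/5.1 (range Δ < 1), Thm 6.1] -/
def KDiag : DiagDesign → Prop
  | .poly _ Δ P => 0 < Δ ∧ Δ < 1 ∧ KMV2000.Admissible P
  | .ac _ Δ q => 0 < Δ ∧ Δ ≤ 1 ∧ IntervalIntegrable q volume 0 1 ∧
      IntervalIntegrable (fun x => q x ^ 2) volume 0 1

/-- **Verdict for `K_fam^diag`** («`p₁(d) ≤ Δ/(1+Δ) ≤ ½` of the even class, `< ½` for `Δ < 1`»): `poly` — KMV's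
Cauchy–Schwarz ratio at main order is `≤ envelope Δ = Δ/(2(1+Δ))` and `< ¼` (ALL-forms scale; `¼` = ½ of even);
`ac` — the IS proportion functional `propIS Δ q ≤ Δ/(1+Δ) ≤ ½` (EVEN scale). Cited, never restated: the terms are
`KMV2000.ratio_one_le` / `ratio_one_lt_quarter` and `OnePieceMollifierCeiling.propIS_le` / `propIS_le_half`.
[cite: KowalskiMichelVanderKam2000, Thm 6.1, §7 p. 21, §8.4 p. 28] -/
def VDiag : DiagDesign → Prop
  | .poly _ Δ P => KMV2000.ratio Δ P 1 ≤ KMV2000.envelope Δ ∧ KMV2000.ratio Δ P 1 < 1 / 4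
  | .ac _ Δ q => OnePieceMollifierCeiling.propIS Δ q ≤ Δ / (1 + Δ) ∧ OnePieceMollifierCeiling.propIS Δ q ≤ 1 / 2

/-- **Status (I) as ONE family** `familyBfamDiag = ⟨DiagDesign, KDiag, VDiag⟩`.
[cite: KowalskiMichelVanderKam2000, Thm 6.1, §7 p. 21] -/
def familyBfamDiag : DesignFamily where
  Design := DiagDesign
  InClass := KDiag
  Verdict := VDiag

/-- **`K_fam^diag` IS DECIDED BY THEOREM** — by cases, from the landed terms (p457854, p458548; nothing re-proved).
[cite: KowalskiMichelVanderKam2000, Thm 6.1, §7 p. 21, §8.4 p. 28] -/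
theorem familyBfamDiag_decided : familyBfamDiag.Decided
  | .poly _ _ _, ⟨hΔ, hΔ1, hP⟩ => ⟨KMV2000.ratio_one_le hΔ hP, KMV2000.ratio_one_lt_quarter hΔ hΔ1 hP⟩
  | .ac _ Δ q, ⟨hΔ, hΔ1, hq, hq2⟩ =>
      ⟨OnePieceMollifierCeiling.propIS_le Δ hΔ q hq hq2, OnePieceMollifierCeiling.propIS_le_half Δ hΔ hΔ1 q hq hq2⟩

/-- The `ac` row is STRICT below the endpoint: `Δ < 1 ⇒ propIS Δ q < ½` («= ½ only at the unattained endpoint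
Δ = 1»; `OnePieceMollifierCeiling.propIS_lt_half`). [cite: KowalskiMichelVanderKam2000, §8.4 p. 28] -/
theorem vdiag_ac_lt_half {A : DiagAspect} {Δ : ℝ} {q : ℝ → ℝ} (h : KDiag (.ac A Δ q)) (hΔ1 : Δ < 1) :
    OnePieceMollifierCeiling.propIS Δ q < 1 / 2 :=
  OnePieceMollifierCeiling.propIS_lt_half Δ h.1 hΔ1 q h.2.2.1 h.2.2.2

/-! ### Part 2 — status (II-a): `K_fam^(A)` beyond the range — CONDITIONAL on three displayed printed inputs -/

/-- Kind tags of the (II-a) strata (KILL-draft §2 K_fam^(A) (i) + §1 (II-a)): level-individual beyond the range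
(C0-Δ>1), its aspect twins ((η)), restricted compatible level averages with mollifier beyond the level-average range
(C2b-long), amplified measures with an expanded length beyond range. Their closing inputs (famE-02 = E-060 / aspect
twin / famE-04b = E-093 / famE-10, famE-13) are open in print and priced XL (B-fam/EDLIST.md); the displayed
deduction below is the same for all four (it is design-independent). [cite: IwaniecConversations2006, §7 p. 97] -/
inductive BeyondKind : Type
  | levelIndividual
  | aspectTwin
  | restrictedLong
  | amplifiedLong

/-- **Designs of `K_fam^(A)` beyond the range** (status (II-a)): kind tag, total expanded logarithmic length `Δ`
(KMV normalisation; for an amplified design the length of the expanded product), polynomial profile `P`. The famE-02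
slot of such a design — «the harmonic mollified second moment at FIXED level with `𝕄 = q̂^Δ`, `1 < Δ`, equals an
explicit main term (diagonal + off-diagonal Kloosterman contribution) + admissible error», MOMENT CURRENCY — is open
in print (KMV p0028 L73–77) and is NOT typed (an open problem is not Literature); it is named here and priced XL
(E-060). [cite: KowalskiMichelVanderKam2000, §8.4 p. 28 (L73–77)] -/
structure BeyondDesign : Type where
  /-- the (II-a) stratum -/
  kind : BeyondKind
  /-- total expanded logarithmic length, KMV normalisation (`> 1` = beyond the range) -/
  Δ : ℝ
  /-- the polynomial profile -/
  P : ℝ[X]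

/-- **Membership in `K_fam^(A)`-beyond**: `1 < Δ` (beyond the diagonal range) and `P` admissible. NO analytic
hypothesis. [cite: KowalskiMichelVanderKam2000, §8.4 p. 28] -/
def KBeyond (d : BeyondDesign) : Prop := 1 < d.Δ ∧ KMV2000.Admissible d.P

/-- **The (A)-deduction at weight `k`, binders DISPLAYED** (REF-E §0b-v9 C3; the statement of
`CentralValueFamilyHalfEdge.goodMass_le_half_total_iwaniecSarnakFamily`, p467703, as an implication from its three
printed inputs): GIVEN `lapidRallis2003_theorem1_gl2Twist` (non-negativity, Lapid–Rallis/Guo),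
`iwaniec2006_twistedHalf` ((7.6) at `½`, famE-06) and `iwaniec2006_mixedMomentOverMass` ((7.3)+(7.4), famE-07, total
mass, `1 < D`), for every `ε > 0` there are `C, δ > 0`, `s₀` with: for all squarefree `N ≥ s₀` and every real
primitive `χ mod D`, `1 < D ≤ N^δ`, `(N, D) = 1`, `χ(−N) = 1`,
`Σʰ_{w_f = 1, L(½,f) ≥ (log N)⁻²} ω_f ≤ (½ + ε)·Σʰ_{w_f = 1} ω_f + C·L(1,χ_D)·(log N)⁴·Σʰ_f ω_f` over `H_k(N)`. Every
`χ_D` here is GENUINE (`1 < D`): no `D = 1`-inclusive shape is displayed. Reading: the TRUE compatible (7.5)-mass is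
`≤ (½ + o(1))` of the even mass exactly when `L(1,χ_D)(log N)⁴·Σʰ1/Σʰ_even → 0` — so no design certifies
`p₁ > 1 − p₂` there unless its closing input fails; that input (famE-02 and twins) is what is priced XL.
[cite: IwaniecConversations2006, §7 (7.3)–(7.7) and p. 97 (L17–22)] -/
def ForcedHalfTotal (k : ℤ) : Prop :=
  lapidRallis2003_theorem1_gl2Twist → iwaniec2006_twistedHalf → iwaniec2006_mixedMomentOverMass →
    ∀ ε : ℝ, 0 < ε →
      ∃ C : ℝ, 0 < C ∧ ∃ δ : ℝ, 0 < δ ∧ ∃ s₀ : ℝ, ∀ N : ℕ+, Squarefree (N : ℕ) →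
        s₀ ≤ ((N : ℕ) : ℝ) →
          ∀ (D : ℕ) [NeZero D] (χ : DirichletCharacter ℂ D), χ.IsPrimitive → MulChar.IsQuadratic χ →
            1 < D → (D : ℝ) ≤ ((N : ℕ) : ℝ) ^ δ → (N : ℕ).Coprime D ∧ χ (-((N : ℕ) : ZMod D)) = 1 →
              harmonicSum (N : ℕ) k
                  (fun f => if rootNumber f = 1 ∧ (Real.log (N : ℕ))⁻¹ ^ 2 ≤ (centralValue f).re
                    then 1 else 0) ≤
                (1 / 2 + ε) * harmonicSum (N : ℕ) k (fun f => if rootNumber f = 1 then 1 else 0) +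
                  C * (χ.LFunction 1).re * Real.log ((N : ℕ) : ℝ) ^ 4 *
                    harmonicSum (N : ℕ) k (fun _ => 1)

/-- **Verdict for `K_fam^(A)`-beyond** (status (II-a), flag CONDITIONAL): the design's diagonal-continued target
`envelope Δ` EXCEEDS `¼` (= ½ of even) — it would close only through its closing input beyond the range — AND the
(A)-deduction `ForcedHalfTotal k` holds at every even weight `k ≥ 2` GIVEN the three displayed printed inputs: «no
(XL)» by input price, localised by the conversion theorem. [cite: IwaniecConversations2006, §7 p. 97 (L17–22)] -/
def VBeyond (d : BeyondDesign) : Prop :=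
  1 / 4 < KMV2000.envelope d.Δ ∧ ∀ k : ℤ, 2 ≤ k → Even k → ForcedHalfTotal k

/-- **Status (II-a) as ONE family** `familyBfamBeyond = ⟨BeyondDesign, KBeyond, VBeyond⟩`.
[cite: IwaniecConversations2006, §7 p. 97] -/
def familyBfamBeyond : DesignFamily where
  Design := BeyondDesign
  InClass := KBeyond
  Verdict := VBeyond

/-- The (A)-deduction holds at every even `k ≥ 2`: it IS `goodMass_le_half_total_iwaniecSarnakFamily` (p467703).
[cite: IwaniecConversations2006, §7 (7.7) and p. 97] -/
theorem forcedHalfTotal_holds {k : ℤ} (hk : 2 ≤ k) (hkev : Even k) : ForcedHalfTotal k :=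
  fun hLR hT hM _ hε => goodMass_le_half_total_iwaniecSarnakFamily hk hkev hLR hT hM hε

/-- Beyond the range the diagonal-continued envelope exceeds `¼` (`envelope 1 = ¼`, `envelope` strictly increasing
on `[0, ∞)`: `KMV2000.envelope_strictMonoOn`). [cite: KowalskiMichelVanderKam2000, §7 p. 21] -/
theorem quarter_lt_envelope {Δ : ℝ} (hΔ : 1 < Δ) : 1 / 4 < KMV2000.envelope Δ := by
  have h1 : KMV2000.envelope 1 = 1 / 4 := by norm_num [KMV2000.envelope]
  rw [← h1]
  exact KMV2000.envelope_strictMonoOn (Set.mem_Ici.2 zero_le_one)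
    (Set.mem_Ici.2 (zero_le_one.trans hΔ.le)) hΔ

/-- **`K_fam^(A)`-beyond IS DECIDED in the intake sense** (verdict = displayed deduction, proved from p457854 and
p467703; flag CONDITIONAL on the displayed inputs). [cite: IwaniecConversations2006, §7 p. 97] -/
theorem familyBfamBeyond_decided : familyBfamBeyond.Decided :=
  fun _ h => ⟨quarter_lt_envelope h.1, fun _ hk hkev => forcedHalfTotal_holds hk hkev⟩

/-- **C3's verdict text, PROVED from the displayed deduction**: under the displayed pointwise positivity of the even
harmonic mass, the total-mass conclusion rewrites as
`Σʰ_good ≤ (½ + ε + C·L(1,χ_D)·(Σʰ_f 1 / Σʰ_even)·(log N)⁴)·Σʰ_even` — «NO at main order exactly when the last term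
`→ 0`». [cite: IwaniecConversations2006, §7 (7.7) and p. 97] -/
theorem forcedHalf_evenMassForm {k : ℤ} (hk : 2 ≤ k) (hkev : Even k)
    (hLR : lapidRallis2003_theorem1_gl2Twist) (hT : iwaniec2006_twistedHalf)
    (hM : iwaniec2006_mixedMomentOverMass) {ε : ℝ} (hε : 0 < ε) :
    ∃ C : ℝ, 0 < C ∧ ∃ δ : ℝ, 0 < δ ∧ ∃ s₀ : ℝ, ∀ N : ℕ+, Squarefree (N : ℕ) →
      s₀ ≤ ((N : ℕ) : ℝ) →
        ∀ (D : ℕ) [NeZero D] (χ : DirichletCharacter ℂ D), χ.IsPrimitive → MulChar.IsQuadratic χ →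
          1 < D → (D : ℝ) ≤ ((N : ℕ) : ℝ) ^ δ → (N : ℕ).Coprime D ∧ χ (-((N : ℕ) : ZMod D)) = 1 →
            0 < harmonicSum (N : ℕ) k (fun f => if rootNumber f = 1 then 1 else 0) →
              harmonicSum (N : ℕ) k
                  (fun f => if rootNumber f = 1 ∧ (Real.log (N : ℕ))⁻¹ ^ 2 ≤ (centralValue f).re
                    then 1 else 0) ≤
                (1 / 2 + ε + C * (χ.LFunction 1).re *
                    (harmonicSum (N : ℕ) k (fun _ => 1) /
                      harmonicSum (N : ℕ) k (fun f => if rootNumber f = 1 then 1 else 0)) *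
                    Real.log ((N : ℕ) : ℝ) ^ 4) *
                  harmonicSum (N : ℕ) k (fun f => if rootNumber f = 1 then 1 else 0) := by
  obtain ⟨C, hC, δ, hδ, s₀, hs₀⟩ := forcedHalfTotal_holds hk hkev hLR hT hM ε hε
  refine ⟨C, hC, δ, hδ, s₀, fun N hsq hN D _ χ hprim hquad hD hDle hcomp hE => ?_⟩
  have h := hs₀ N hsq hN D χ hprim hquad hD hDle hcomp
  set Sg := harmonicSum (N : ℕ) k
    (fun f => if rootNumber f = 1 ∧ (Real.log (N : ℕ))⁻¹ ^ 2 ≤ (centralValue f).re then 1 else 0)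
  set Se := harmonicSum (N : ℕ) k (fun f => if rootNumber f = 1 then 1 else 0)
  set Sa := harmonicSum (N : ℕ) k (fun _ => 1)
  set L := (χ.LFunction 1).re
  set lg := Real.log ((N : ℕ) : ℝ) ^ 4
  have hSa : Sa / Se * Se = Sa := div_mul_cancel₀ Sa hE.ne'
  have e : (1 / 2 + ε + C * L * (Sa / Se) * lg) * Se = (1 / 2 + ε) * Se + C * L * lg * Sa := by
    calc (1 / 2 + ε + C * L * (Sa / Se) * lg) * Se
        = (1 / 2 + ε) * Se + C * L * lg * (Sa / Se * Se) := by ring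
      _ = (1 / 2 + ε) * Se + C * L * lg * Sa := by rw [hSa]
  rw [e]
  exact h

/-! ### Part 3 — status (II-b): `K_fam^(A)` inside the ranges — GIVEN B-AH(fam), 0 rows evaluated -/

/-- **In-range members of `K_fam^(A)`** (status (II-b), KILL-draft §2 (ii)/(iii)/(iv)): `restricted Δ P` — a
RESTRICTED (compatible) level average with one-piece mollifier of logarithmic length `Δ` w.r.t. `√|family|`
(IS2000's own regime); `bpz q D θ` — a BPZ-type product-mollifier design at the compatible prime level `q` for the
modulus `D`, mollifier length `X = q^θ` (BPZ's asymptotics PROVED for `θ < 1/6`, p457180 Props 2.1–2.3; the order-0 coordinates of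
every (iii) row presuppose an unprinted order-0 evaluation and, for `1/6 ≤ θ < ½`, the extension of Props 2.2/2.3 — GIVENs
displayed in `NarrowMember.InRange`'s docstring, REF-B3 D4 (a)); `amplified S α Δ P` — the amplified harmonic measure `ω_f|A_f|²` with
amplifier supported on the prime set `S`, amplifier length `q̂^α`, mollifier `q̂^Δ`, profile `P` (`χ_D(ℓ)` frozen to
`μ(ℓ) = −1` on `S`, C3′). [cite: IwaniecConversations2006, §7 (7.5)–(7.6), p. 97] -/
inductive NarrowMember : Type
  | restricted (Δ : ℝ) (P : ℝ[X])
  | bpz (q D : ℕ) (θ : ℝ)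
  | amplified (S : Finset ℕ) (α Δ : ℝ) (P : ℝ[X])

/-- **«Inside the ranges»** for the in-range members: (ii) `0 < Δ ≤ 1` («(length)² ≤ |family|»), `P` admissible;
(iii) `q` prime, `1 < D`, `D ∣ q + 1` (i.e. `q ≡ −1 (mod D)`, so `χ(−q) = χ(1) = 1` for EVERY character mod `D`:
a parity-uniform compatible prime level, KILL-draft §2 PARITY INDEX), `0 < θ < ½` (`X = q^θ` inside `√|family|`:
`X² ≤ q`, `Δ_bpz = 2θ ≤ 1`; REF-B3 KILL-audit D4 (a), ls-barrier-plan 00:00:01Z, wording REF-B3 00:02:10Z): «(iii): BPZ's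
printed mollified-moment asymptotics (p457180, Props 2.1–2.3: `q, X ≥ D⁸`; `X ≥ D²⁴ ∧ D⁸X⁶ ≪ q^{1−ε}`) are PROVED for
`θ < 1/6`; whether they determine the order-0 coordinates `pOneA/pTwoA` is NOT settled in print (ls-Bfam-typer-1 g2
U2-SCOPING v0.1, REF-B3 PASS as scoping verdict 00:03:39Z: the order-0 mollified product second moment in the (A)-world to
relative o(1) is an unprinted input, famE candidate); every (iii) row's coordinates therefore presuppose that order-0
evaluation, and rows with `1/6 ≤ θ < 1/2` additionally the extension of Props 2.2/2.3 beyond `D⁸X⁶ ≪ q^{1−ε}` — all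
displayed as part of the row's GIVEN beside B-AH(fam); the open question on the whole stratum is functional, hence
(II-b).»; (iv) `S` a set of primes, `0 ≤ α`, `0 < Δ`, and ALL expanded lengths in range — the second-moment product `A·M`: `α + Δ ≤ 1`, AND the
first-moment expanded length of `A²·M`: `2α + Δ ≤ 1` (REF-B3 KILL-audit D1; the same first-moment bound as
`KMV2000.AmplifiedLengthBudget`'s `(len A)²·len M ≤ q̂^θ`, p473788) — `P` admissible; an amplified design with
`2α + Δ > 1` (or `α + Δ > 1`) is a `BeyondKind.amplifiedLong` member of status (II-a), not a (iv) member. NO analytic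
hypothesis. [cite: BuiPrattZaharescu2023, Thm 1.2 and Props 2.1–2.3 (ranges)] -/
def NarrowMember.InRange : NarrowMember → Prop
  | .restricted Δ P => 0 < Δ ∧ Δ ≤ 1 ∧ KMV2000.Admissible P
  | .bpz q D θ => q.Prime ∧ 1 < D ∧ D ∣ q + 1 ∧ 0 < θ ∧ θ < 1 / 2
  | .amplified S α Δ P =>
      (∀ ℓ ∈ S, ℓ.Prime) ∧ 0 ≤ α ∧ 0 < Δ ∧ α + Δ ≤ 1 ∧ 2 * α + Δ ≤ 1 ∧ KMV2000.Admissible P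

/-- **Designs of status (II-b)**: an in-range member together with the two (A)-world MAIN-ORDER values of its
certified functionals — `pOneA = p₁(d;(A)-data)` (untwisted side) and `pTwoA = p₂(d;(A)-data)` (twisted side) —
carried as UNEVALUATED real coordinates: 0 rows are evaluated at this word (REF-B3 blocks 4–5); a filed two-lineage
evaluation fixes them for a member and UPGRADES its row («no (decided)» if `p₁A + p₂A ≤ 1`, exit x1 = a proof of
`¬(A)` through the conversion theorems if `> 1`). [cite: IwaniecConversations2006, §7 (7.7) and p. 97] -/
structure NarrowDesign : Type where
  /-- the in-range member -/
  member : NarrowMember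
  /-- (A)-world main-order value of the member's untwisted functional — NOT EVALUATED -/
  pOneA : ℝ
  /-- (A)-world main-order value of the member's twisted functional — NOT EVALUATED -/
  pTwoA : ℝ

/-- **B-AH(fam) for the design `d`** (E-014 fam instance, PREMISE NAMED NOT PROVED): «the (A)-world main-order value
of its certified functional satisfies `p₁(d;(A)-data) + p₂(d;(A)-data) ≤ 1 + o(1)`» — at main order, `≤ 1`. Refutable
row by row; (c)-door E-085. [cite: IwaniecConversations2006, §7 (7.7)] -/
def BAHfam (d : NarrowDesign) : Prop := d.pOneA + d.pTwoA ≤ 1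

/-- **«`d` certifies»**: the member's (A)-world functional values give `p₁ + p₂ > 1` (the only way an IS design
closes (7.7) at main order). [cite: IwaniecConversations2006, §7 (7.7)] -/
def NarrowDesign.Certifies (d : NarrowDesign) : Prop := 1 < d.pOneA + d.pTwoA

/-- **Membership in `K_fam^(A)`-in-range** = the member is inside its ranges. NO analytic hypothesis.
[cite: IwaniecConversations2006, §7 (7.5)–(7.6)] -/
def KNarrow (d : NarrowDesign) : Prop := d.member.InRange

/-- **Verdict for status (II-b), flag GIVEN**: `B-AH(fam)(d) → ¬ d certifies` — premise displayed as a bare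
hypothesis; «0 ROWS EVALUATED; excluded from the decided scope of this KILL and re-opened automatically on the first
filed evaluation». [cite: IwaniecConversations2006, §7 (7.7)] -/
def VNarrow (d : NarrowDesign) : Prop := BAHfam d → ¬ d.Certifies

/-- **Status (II-b) as ONE family** `familyBfamNarrow = ⟨NarrowDesign, KNarrow, VNarrow⟩`.
[cite: IwaniecConversations2006, §7 (7.7)] -/
def familyBfamNarrow : DesignFamily where
  Design := NarrowDesign
  InClass := KNarrow
  Verdict := VNarrow

/-- **Status (II-b) is decided ONLY in the trivial sense «premise ⇒ conclusion»** (nothing evaluated; the premise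
is load-bearing: `narrow_premise_loadBearing`). [cite: IwaniecConversations2006, §7 (7.7)] -/
theorem familyBfamNarrow_decided : familyBfamNarrow.Decided := fun _ _ h => not_lt.2 h

/-- The (II-b) premise is LOAD-BEARING: without `BAHfam` the verdict shape fails on the class (the in-range member
`restricted 1 x²` with coordinates `(1, 1)` would certify). [cite: IwaniecConversations2006, §7 (7.7)] -/
theorem narrow_premise_loadBearing : ¬ ∀ d : NarrowDesign, KNarrow d → ¬ d.Certifies := by
  intro h
  exact h ⟨.restricted 1 (X ^ 2), 1, 1⟩ ⟨one_pos, le_rfl, KMV2000.admissible_X_sq⟩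
    (by norm_num [NarrowDesign.Certifies])

/-! ### Part 4 — the union family `familyBfam` and the word's LIST `bfamWord` -/

/-- **Designs of `K_fam`**, one constructor per status. [cite: IwaniecConversations2006, §7 (7.5)–(7.7)] -/
inductive BfamDesign : Type
  | diag (d : DiagDesign)
  | beyond (d : BeyondDesign)
  | narrow (d : NarrowDesign)

/-- **Membership in `K_fam`** = the status family's class. [cite: IwaniecConversations2006, §7 (7.5)–(7.7)] -/
def KBfam : BfamDesign → Prop
  | .diag d => KDiag d
  | .beyond d => KBeyond d
  | .narrow d => KNarrow d

/-- **Verdict on `K_fam`** = the status family's verdict (flags: (I) DECIDED BY THEOREM, (II-a) CONDITIONAL on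
displayed inputs, (II-b) GIVEN B-AH(fam), 0 rows evaluated). [cite: IwaniecConversations2006, §7 (7.5)–(7.7)] -/
def VBfam : BfamDesign → Prop
  | .diag d => VDiag d
  | .beyond d => VBeyond d
  | .narrow d => VNarrow d

/-- **`K_fam` as ONE family** `familyBfam = ⟨BfamDesign, KBfam, VBfam⟩`. [cite: IwaniecConversations2006, §7 (7.5)–(7.7)] -/
def familyBfam : DesignFamily where
  Design := BfamDesign
  InClass := KBfam
  Verdict := VBfam

/-- **`familyBfam` is decided in the intake sense** — by cases on the status.
[cite: IwaniecConversations2006, §7 (7.5)–(7.7)] -/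
theorem familyBfam_decided : familyBfam.Decided
  | .diag d, h => familyBfamDiag_decided d h
  | .beyond d, h => familyBfamBeyond_decided d h
  | .narrow d, h => familyBfamNarrow_decided d h

/-- **The word's families as a LIST, one per status** (flags by term: DECIDED / CONDITIONAL / GIVEN).
[cite: IwaniecConversations2006, §7 (7.5)–(7.7)] -/
def bfamWord : List DesignFamily := [familyBfamDiag, familyBfamBeyond, familyBfamNarrow]

/-- **The word's list is decided in the intake sense** (`ClassDecided`; NOT «the class K_fam is decided»: status
(II-a) is conditional on its displayed inputs and status (II-b) is GIVEN its premise with 0 rows evaluated).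
[cite: IwaniecConversations2006, §7 (7.5)–(7.7)] -/
theorem bfamWord_decided : ClassDecided bfamWord :=
  classDecided_cons familyBfamDiag_decided <|
    classDecided_cons familyBfamBeyond_decided <|
      classDecided_cons familyBfamNarrow_decided classDecided_nil

/-- The union family prepended to the list is decided too. [cite: IwaniecConversations2006, §7 (7.5)–(7.7)] -/
theorem familyBfam_bfamWord_decided : ClassDecided (familyBfam :: bfamWord) :=
  classDecided_cons familyBfam_decided bfamWord_decided

/-- Membership in the list, by name. [cite: IwaniecConversations2006, §7 (7.5)–(7.7)] -/
theorem mem_bfamWord_iff (F : DesignFamily) :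
    F ∈ bfamWord ↔ F = familyBfamDiag ∨ F = familyBfamBeyond ∨ F = familyBfamNarrow := by
  simp [bfamWord]

/-! ### Part 5 — C2 by term, C4 witnesses -/

/-- **C2 by term**: each constructor's class and verdict ARE the displayed predicates (`Iff.rfl`).
[cite: IwaniecConversations2006, §7 (7.5)–(7.7)] -/
theorem kbfam_rows_iff (A : DiagAspect) (Δ : ℝ) (P : ℝ[X]) (q : ℝ → ℝ) (κ : BeyondKind) (m : NarrowMember)
    (p₁ p₂ : ℝ) :
    (KBfam (.diag (.poly A Δ P)) ↔ 0 < Δ ∧ Δ < 1 ∧ KMV2000.Admissible P) ∧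
      (VBfam (.diag (.poly A Δ P)) ↔
        KMV2000.ratio Δ P 1 ≤ KMV2000.envelope Δ ∧ KMV2000.ratio Δ P 1 < 1 / 4) ∧
      (KBfam (.diag (.ac A Δ q)) ↔ 0 < Δ ∧ Δ ≤ 1 ∧ IntervalIntegrable q volume 0 1 ∧
        IntervalIntegrable (fun x => q x ^ 2) volume 0 1) ∧
      (VBfam (.diag (.ac A Δ q)) ↔ OnePieceMollifierCeiling.propIS Δ q ≤ Δ / (1 + Δ) ∧
        OnePieceMollifierCeiling.propIS Δ q ≤ 1 / 2) ∧
      (KBfam (.beyond ⟨κ, Δ, P⟩) ↔ 1 < Δ ∧ KMV2000.Admissible P) ∧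
      (VBfam (.beyond ⟨κ, Δ, P⟩) ↔
        1 / 4 < KMV2000.envelope Δ ∧ ∀ k : ℤ, 2 ≤ k → Even k → ForcedHalfTotal k) ∧
      (KBfam (.narrow ⟨m, p₁, p₂⟩) ↔ m.InRange) ∧
      (VBfam (.narrow ⟨m, p₁, p₂⟩) ↔ (p₁ + p₂ ≤ 1 → ¬ 1 < p₁ + p₂)) :=
  ⟨Iff.rfl, Iff.rfl, Iff.rfl, Iff.rfl, Iff.rfl, Iff.rfl, Iff.rfl, Iff.rfl⟩

/-- **C4 — the class is inhabited, one member per status, by TERM (rationals only)**: (I) KMV's `P₀ = x²` at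
`Δ = ½` and the AC profile `q ≡ 1` (IS `p(t) = t`) at `Δ = 1`; (II-a) `x²` continued to `Δ = 3/2` (C0-Δ>1); (II-b) the
compatible prime-level BPZ member (`q = 11`, `D = 3`, `3 ∣ 12`, `X = q^{1/8}`), the restricted average
`(Δ, P) = (1, x²)`, the amplified member on the primes `{2, 3}` with `(α, Δ) = (¼, ½)` — for ANY unevaluated
coordinates `(p₁, p₂)`. [cite: KowalskiMichelVanderKam2000, §7 p. 21 (P₀ = x²)] -/
theorem kbfam_inhabited (p₁ p₂ : ℝ) :
    KBfam (.diag (.poly .levelIndividual (1 / 2) (X ^ 2))) ∧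
      KBfam (.diag (.ac .levelIndividual 1 (fun _ => 1))) ∧
      KBfam (.beyond ⟨.levelIndividual, 3 / 2, X ^ 2⟩) ∧
      KBfam (.narrow ⟨.bpz 11 3 (1 / 8), p₁, p₂⟩) ∧
      KBfam (.narrow ⟨.restricted 1 (X ^ 2), p₁, p₂⟩) ∧
      KBfam (.narrow ⟨.amplified {2, 3} (1 / 4) (1 / 2) (X ^ 2), p₁, p₂⟩) := by
  refine ⟨⟨by norm_num, by norm_num, KMV2000.admissible_X_sq⟩,
    ⟨one_pos, le_rfl, intervalIntegrable_const, intervalIntegrable_const⟩,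
    ⟨by norm_num, KMV2000.admissible_X_sq⟩,
    ⟨by norm_num, by norm_num, by norm_num, by norm_num, by norm_num⟩,
    ⟨one_pos, le_rfl, KMV2000.admissible_X_sq⟩,
    ⟨?_, by norm_num, by norm_num, by norm_num, by norm_num, KMV2000.admissible_X_sq⟩⟩
  intro ℓ hℓ
  simp only [Finset.mem_insert, Finset.mem_singleton] at hℓ
  rcases hℓ with rfl | rfl <;> norm_num

/-- The three C4 status witnesses inhabit the three families of the LIST (same terms, through the list's own
classes). [cite: KowalskiMichelVanderKam2000, §7 p. 21 (P₀ = x²)] -/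
theorem bfamWord_inhabited (p₁ p₂ : ℝ) :
    familyBfamDiag.InClass (.poly .levelIndividual (1 / 2) (X ^ 2)) ∧
      familyBfamBeyond.InClass ⟨.levelIndividual, 3 / 2, X ^ 2⟩ ∧
      familyBfamNarrow.InClass ⟨.bpz 11 3 (1 / 8), p₁, p₂⟩ :=
  ⟨(kbfam_inhabited p₁ p₂).1, (kbfam_inhabited p₁ p₂).2.2.1, (kbfam_inhabited p₁ p₂).2.2.2.1⟩

/-- **The (I)/(II-a) split is by the SAME functional at the SAME scale**: the C4 witnesses' diagonal targets are
`envelope ½ = 1/6 < ¼` (inside: no closing) and `envelope (3/2) = 3/10 > ¼` (beyond: a candidate only through its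
input) — the third knife edge `¼` (= ½ of even) sits exactly at `Δ = 1` (`KMV2000.envelope_eq_quarter_iff`).
[cite: KowalskiMichelVanderKam2000, §7 p. 21, §8.4 p. 28] -/
theorem bfam_edge_values :
    KMV2000.envelope (1 / 2) = 1 / 6 ∧ KMV2000.envelope (3 / 2) = 3 / 10 ∧ KMV2000.envelope 1 = 1 / 4 := by
  refine ⟨?_, ?_, ?_⟩ <;> norm_num [KMV2000.envelope]

end Repair

end Literature.NumberTheory.LFunctions.Zhang2022

end
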